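import Mathlib

/-!
# Beta/ElimJacobianAlgebra — the coefficient bookkeeping behind the second-order expansion of the
b₀-elimination Jacobian (β sub-cell, pv03 lineage: HOME/b2b-balaban-pv03/JACOBIAN.md (J1)–(J3), §7;
consumed by row an2, HOME/BETA/AN2.md §8.10 (c), GAPS C-an2-9 / G-pv03-3 / C-pv03-8)

HONEST FRAMING (cell `pub-balaban`, β sub-cell).  The β sub-cell tries to discharge the one-loop input of
[Balaban1987RG1] Theorem 2 (`FlowStep.BetaPertH`); doing so would make Bałaban's ultraviolet STABILITY theorem
unconditional — it is NOT the continuum limit and NOT the Clay problem, and this module is far less than that: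
it kernel-checks the ELEMENTARY ALGEBRA (formal power series coefficients, a non-commutative variance identity,
traces of antisymmetric matrices, a lattice moment sum, and three lines of arithmetic) used when the cell expands
the determinant of the b₀-elimination block of [Balaban1987RG1] (2.4)/(0.12) to second order in the field
(JACOBIAN.md (J2)) and evaluates it on a constant-curvature background (AN2.md §8.10 (c): the slope
`m_J = −C_ad·L(L²−1)/36`).  NOTHING about Bałaban's operators is asserted here: that the elimination block has
the closed form (J1) `S_c = Φ(ad Z_c)·[Ψ̃(ad Z_c) − L^{−d} Σ' Ψ̃(ad X_{c,x})]·Ad(·)`, that `ad` of a Lie algebra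
element is antisymmetric for the invariant form, and that the linearised loop fluxes on constant curvature are
`L·(x − c₋)_ν` (lattice Stokes) are statements of the cell's ANALYSIS (JACOBIAN.md §3, §7; toy-verified there by
two independent numerical engines), not of this file.  Value = kernel certificate of coefficient bookkeeping,
NOT summit progress.

DICTIONARY (which cell step each section serves; dictionary sentences only, never hypotheses).
* §1  `Φ(A) = (e^A − 1)/A`, `Ψ̃(A) = A/(1 − e^{−A})` as formal power series over a `ℚ`-algebra: `X·Φ = exp − 1`,
  `Φ·Ψ̃ = exp` (step (e) of the derivation of (J1)); the coefficients `Ψ̃ = 1 + A/2 + A²/12 + 0·A³ − A⁴/720 + …`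
  (the `½` of the first-order Jensen cancellation, the `1/12` of (J2), «no cubic term», and the `1/720` of the exact
  toy specialisation `g(φ) = 1 − (φ/2)cot(φ/2) = φ²/12 + φ⁴/720 + …` of JACOBIAN.md §7); the formal logarithm
  `log Φ = A/2 + A²/24 + 0·A³ − A⁴/2880 + …` characterised by `Φ·(log Φ)′ = Φ′`, `(log Φ)(0) = 0` with uniqueness
  (the `1/24` of `log det Φ(ad Z_c)` in (J2)), and `log Ψ̃ = X − log Φ`.
* §2  the weighted non-commutative variance identity `Σ w_x B_x² − (Σ w_x B_x)² = Σ w_x (B_x − B̄)²` for `Σ w = 1`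
  in any (non-commutative) algebra — the step of (J2) turning `(ad Z_c)² − L^{−d}Σ_x (ad X_{c,x})²` into minus the
  loop-flux variance.
* §3  real antisymmetric matrices: odd powers are traceless (no linear and no cubic term in (J2)) and
  `tr(A·A) = −Σ_{ij} A_{ij}² ≤ 0` (so `‖Y‖²_ad := −tr (ad Y)² ≥ 0`, the sign bookkeeping of (J2)/(J3)).
* §4  the block second moment `Σ_{0 ≤ i < L} (i − (L−1)/2)² = L(L²−1)/12` and its box form (a line times a
  transverse block of `M` sites gives `M·L(L²−1)/12`; with `M = L^d`: `L^{d+1}(L²−1)/12`) — an2's «Stokes count»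
  `Σ_{x∈B(c₋)} (x − c₋)_ν² = L^d(L²−1)/12` (AN2.md §8.10 (c); JACOBIAN.md §7 prints 6, 50, 18, 54).
* §5  the arithmetic of the slope: Hessian per in-plane cell `−(1/(6L))·C·L²·(L^d(L²−1)/12) = −C·L^{d+1}(L²−1)/72`
  (`1/(6L) = 2·1/(12L)` from `d²/dt² t² = 2`), two in-plane cells per coarse site and `L^d` fine sites per coarse
  site give `m_J = −C·L(L²−1)/36` per unit fine volume (AN2.md §8.10 (c); JACOBIAN.md §7 table).
WHAT IS NOT PROVED: the closed form (J1) itself, lattice Stokes, anything about `ad`/`Ad` of a compact Lie algebra,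
matrix (as opposed to formal/scalar) versions of the logarithmic expansions, any estimate, any `O(·)` remainder,
anything about `k`, `L → ∞` or the infinite volume.

ABSOLUTE RULE.  No internally-minted statement enters as a cited fact: there are no cited facts here at all — every
declaration is `[folklore]`, proved in this file from Mathlib (`PowerSeries.exp`, `bernoulli'PowerSeries`,
`bernoulli'PowerSeries_mul_exp_sub_one`, `bernoulli'_eq_zero_of_odd`, `PowerSeries.derivative`); the manuscripts'
disputed steps are not used.  Companion prose: HOME/b2b-balaban-pv03/JACOBIAN.md v1.3; GAPS rows G-pv03-3, C-pv03-8,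
C-an2-9.
-/

namespace Literature.MathematicalPhysics.QuantumFieldTheory.Balaban1983to89.Beta.ElimJacobianAlgebra

open PowerSeries Nat Finset
open scoped Matrix

/-! ## §1. The formal power series `Φ`, `Ψ̃`, `log Φ` -/

section Series

variable (A : Type*) [CommRing A] [Algebra ℚ A]

/-- `[folklore]` `Φ(X) = (e^X − 1)/X = Σ_{n ≥ 0} Xⁿ/(n+1)!`. -/
def phi : PowerSeries A := mk fun n => algebraMap ℚ A (1 / ((n + 1)! : ℚ))

/-- `[folklore]` `Ψ̃(X) = X/(1 − e^{−X}) = X·e^X/(e^X − 1) = Σ_{n ≥ 0} B⁺_n Xⁿ/n!` — Mathlib's exponential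
generating function of the Bernoulli numbers `bernoulli'` (the convention with `B⁺₁ = +1/2`). -/
def psiTilde : PowerSeries A := bernoulli'PowerSeries A

/-- `[folklore]` the formal logarithm of `Φ`: `log Φ(X) = Σ_{n ≥ 1} B⁺_n Xⁿ/(n·n!)` (characterised below by
`Φ·(log Φ)′ = Φ′` and vanishing constant term). -/
def logPhi : PowerSeries A :=
  mk fun n => if n = 0 then 0 else algebraMap ℚ A (bernoulli' n / ((n : ℚ) * (n ! : ℚ)))

variable {A}

/-- `[folklore]` coefficients of `Φ`: `1/(n+1)!`. -/
@[simp] theorem coeff_phi (n : ℕ) : coeff n (phi A) = algebraMap ℚ A (1 / ((n + 1)! : ℚ)) :=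
  coeff_mk _ _

/-- `[folklore]` coefficients of `Ψ̃`: `B⁺_n/n!`. -/
@[simp] theorem coeff_psiTilde (n : ℕ) : coeff n (psiTilde A) = algebraMap ℚ A (bernoulli' n / (n ! : ℚ)) := by
  simp [psiTilde, bernoulli'PowerSeries]

/-- `[folklore]` coefficients of `log Φ`: `0`, then `B⁺_n/(n·n!)`. -/
@[simp] theorem coeff_logPhi (n : ℕ) :
    coeff n (logPhi A) = if n = 0 then 0 else algebraMap ℚ A (bernoulli' n / ((n : ℚ) * (n ! : ℚ))) :=
  coeff_mk _ _

/-- `[folklore]` `Φ(0) = 1`. -/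
@[simp] theorem constantCoeff_phi : constantCoeff (phi A) = 1 := by
  rw [← coeff_zero_eq_constantCoeff_apply, coeff_phi]; simp

/-- `[folklore]` `Ψ̃(0) = 1`. -/
@[simp] theorem constantCoeff_psiTilde : constantCoeff (psiTilde A) = 1 := by
  rw [← coeff_zero_eq_constantCoeff_apply, coeff_psiTilde]; simp [bernoulli'_zero]

/-- `[folklore]` `(log Φ)(0) = 0`. -/
@[simp] theorem constantCoeff_logPhi : constantCoeff (logPhi A) = 0 := by
  rw [← coeff_zero_eq_constantCoeff_apply, coeff_logPhi]; simp

/-- `[folklore]` `Φ` is invertible as a formal power series. -/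
theorem isUnit_phi : IsUnit (phi A) := by
  rw [isUnit_iff_constantCoeff, constantCoeff_phi]; exact isUnit_one

/-- `[folklore]` `Ψ̃` is invertible as a formal power series. -/
theorem isUnit_psiTilde : IsUnit (psiTilde A) := by
  rw [isUnit_iff_constantCoeff, constantCoeff_psiTilde]; exact isUnit_one

variable (A)

/-- `[folklore]` `X·Φ(X) = e^X − 1`. -/
theorem X_mul_phi : X * phi A = exp A - 1 := by
  ext n
  cases n with
  | zero => simp
  | succ n =>
    rw [coeff_succ_X_mul, coeff_phi, map_sub, coeff_exp, coeff_one]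
    simp

/-- `[folklore]` Mathlib's defining identity of `Ψ̃`: `Ψ̃(X)·(e^X − 1) = X·e^X`. -/
theorem psiTilde_mul_exp_sub_one : psiTilde A * (exp A - 1) = X * exp A :=
  bernoulli'PowerSeries_mul_exp_sub_one A

/-- `[folklore]` `Φ·Ψ̃ = exp` — step (e) of the derivation of (J1): `e^{ad Z} = Φ(ad Z)·Ψ̃(ad Z)`. -/
theorem phi_mul_psiTilde : phi A * psiTilde A = exp A := by
  apply X_mul_cancel
  calc X * (phi A * psiTilde A) = psiTilde A * (X * phi A) := by ring
    _ = psiTilde A * (exp A - 1) := by rw [X_mul_phi]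
    _ = X * exp A := psiTilde_mul_exp_sub_one A

/-- `[folklore]` `X·Φ′ = exp − Φ` (differentiate `X·Φ = exp − 1`). -/
theorem X_mul_derivative_phi : X * d⁄dX A (phi A) = exp A - phi A := by
  have h := congrArg (d⁄dX A) (X_mul_phi A)
  rw [Derivation.leibniz, map_sub, Derivation.map_one_eq_zero, sub_zero, derivative_exp, derivative_X,
    smul_eq_mul, smul_eq_mul, mul_one] at h
  -- h : X * d⁄dX A (phi A) + phi A = exp A
  linear_combination h

/-- `[folklore]` `X·(log Φ)′ = Ψ̃ − 1`. -/
theorem X_mul_derivative_logPhi : X * d⁄dX A (logPhi A) = psiTilde A - 1 := by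
  ext n
  cases n with
  | zero => simp
  | succ n =>
    rw [coeff_succ_X_mul, coeff_derivative, coeff_logPhi, map_sub, coeff_psiTilde, coeff_one]
    simp only [if_false, add_eq_zero, one_ne_zero, and_false]
    rw [show ((n : A) + 1) = algebraMap ℚ A ((n : ℚ) + 1) by simp, ← map_mul, sub_zero]
    congr 1
    have h1 : ((n + 1 : ℕ) : ℚ) = (n : ℚ) + 1 := by push_cast; ring
    rw [h1]
    have h2 : ((n : ℚ) + 1) ≠ 0 := by positivity
    have h3 : ((n + 1)! : ℚ) ≠ 0 := by positivity
    field_simp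

/-- `[folklore]` THE DEFINING PROPERTY of `log Φ`: `Φ·(log Φ)′ = Φ′` (with `(log Φ)(0) = 0`,
`constantCoeff_logPhi`). -/
theorem phi_mul_derivative_logPhi : phi A * d⁄dX A (logPhi A) = d⁄dX A (phi A) := by
  apply X_mul_cancel
  calc X * (phi A * d⁄dX A (logPhi A)) = phi A * (X * d⁄dX A (logPhi A)) := by ring
    _ = phi A * (psiTilde A - 1) := by rw [X_mul_derivative_logPhi]
    _ = exp A - phi A := by rw [mul_sub, phi_mul_psiTilde, mul_one]
    _ = X * d⁄dX A (phi A) := (X_mul_derivative_phi A).symm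

variable {A}

/-- `[folklore]` UNIQUENESS of the formal logarithm: over an additively torsion-free `ℚ`-algebra, a power series
`G` with `Φ·G′ = Φ′` and `G(0) = 0` is `log Φ`.  (So `logPhi` is not a choice: it is the logarithm of `Φ`.) -/
theorem eq_logPhi_of_phi_mul_derivative_eq [IsAddTorsionFree A] {G : PowerSeries A}
    (hG : phi A * d⁄dX A G = d⁄dX A (phi A)) (h0 : constantCoeff G = 0) : G = logPhi A := by
  apply derivative.ext
  · apply (isUnit_phi (A := A)).mul_left_cancel
    rw [hG, phi_mul_derivative_logPhi]
  · rw [h0, constantCoeff_logPhi]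

omit [Algebra ℚ A] in
/-- `[folklore]` the general uniqueness statement used above: an invertible `F` determines the solution of
`F·G′ = F′`, `G(0) = c`. -/
theorem log_unique [IsAddTorsionFree A] {F G₁ G₂ : PowerSeries A} (hF : IsUnit F)
    (h₁ : F * d⁄dX A G₁ = d⁄dX A F) (h₂ : F * d⁄dX A G₂ = d⁄dX A F)
    (h0 : constantCoeff G₁ = constantCoeff G₂) : G₁ = G₂ :=
  derivative.ext (hF.mul_left_cancel (h₁.trans h₂.symm)) h0

variable (A)

/-- `[folklore]` `log Ψ̃ = X − log Φ` in the same sense: the series `X − log Φ` solves `Ψ̃·G′ = Ψ̃′`, `G(0) = 0`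
(because `Φ·Ψ̃ = exp`). -/
theorem psiTilde_mul_derivative_X_sub_logPhi :
    psiTilde A * d⁄dX A (X - logPhi A) = d⁄dX A (psiTilde A) := by
  apply (isUnit_phi (A := A)).mul_left_cancel
  have hprod := congrArg (d⁄dX A) (phi_mul_psiTilde A)
  rw [Derivation.leibniz, derivative_exp, smul_eq_mul, smul_eq_mul] at hprod
  -- hprod : phi A * d⁄dX (psiTilde A) + psiTilde A * d⁄dX (phi A) = exp A
  have hlog := phi_mul_derivative_logPhi A
  rw [map_sub, derivative_X]
  calc phi A * (psiTilde A * (1 - d⁄dX A (logPhi A)))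
        = phi A * psiTilde A - psiTilde A * (phi A * d⁄dX A (logPhi A)) := by ring
    _ = exp A - psiTilde A * d⁄dX A (phi A) := by rw [phi_mul_psiTilde, hlog]
    _ = phi A * d⁄dX A (psiTilde A) := by linear_combination (-1 : PowerSeries A) * hprod

/-- `[folklore]` `(X − log Φ)(0) = 0`. -/
theorem constantCoeff_X_sub_logPhi : constantCoeff (X - logPhi A : PowerSeries A) = 0 := by
  simp

end Series

/-! ### The rational coefficients (over `ℚ`; any `ℚ`-algebra receives them through `algebraMap`) -/

section Coefficients

/-- `[folklore]` `Ψ̃ = 1 + …`. -/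
theorem coeff_psiTilde_zero : coeff 0 (psiTilde ℚ) = 1 := by norm_num [bernoulli'_zero]
/-- `[folklore]` the `½` of the first-order (Jensen) term of (J2), which cancels. -/
theorem coeff_psiTilde_one : coeff 1 (psiTilde ℚ) = 1 / 2 := by norm_num [bernoulli'_one]
/-- `[folklore]` the `1/12` of (J2). -/
theorem coeff_psiTilde_two : coeff 2 (psiTilde ℚ) = 1 / 12 := by
  norm_num [bernoulli'_two, Nat.factorial]
/-- `[folklore]` «no cubic term» in (J2). -/
theorem coeff_psiTilde_three : coeff 3 (psiTilde ℚ) = 0 := by norm_num [bernoulli'_three]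
/-- `[folklore]` the `1/720` of the exact toy specialisation (JACOBIAN.md §7, `g(φ) = φ²/12 + φ⁴/720 + …`). -/
theorem coeff_psiTilde_four : coeff 4 (psiTilde ℚ) = -1 / 720 := by
  norm_num [bernoulli'_four, Nat.factorial]
/-- `[folklore]` all odd coefficients of `Ψ̃` beyond the first vanish (`Ψ̃(X) − X/2` is even). -/
theorem coeff_psiTilde_eq_zero_of_odd {n : ℕ} (hn : Odd n) (h1 : 1 < n) : coeff n (psiTilde ℚ) = 0 := by
  simp [bernoulli'_eq_zero_of_odd hn h1]

/-- `[folklore]` `Φ = 1 + …`. -/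
theorem coeff_phi_zero : coeff 0 (phi ℚ) = 1 := by norm_num
/-- `[folklore]` `Φ = 1 + X/2 + …`. -/
theorem coeff_phi_one : coeff 1 (phi ℚ) = 1 / 2 := by norm_num [Nat.factorial]
/-- `[folklore]` `Φ = 1 + X/2 + X²/6 + …`. -/
theorem coeff_phi_two : coeff 2 (phi ℚ) = 1 / 6 := by norm_num [Nat.factorial]
/-- `[folklore]` `Φ = 1 + X/2 + X²/6 + X³/24 + …`. -/
theorem coeff_phi_three : coeff 3 (phi ℚ) = 1 / 24 := by norm_num [Nat.factorial]

/-- `[folklore]` `log Φ = 0 + …`. -/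
theorem coeff_logPhi_zero : coeff 0 (logPhi ℚ) = 0 := by norm_num
/-- `[folklore]` `log Φ = X/2 + …` (the `½ tr ad Z_c` of (J2), which vanishes by §3). -/
theorem coeff_logPhi_one : coeff 1 (logPhi ℚ) = 1 / 2 := by norm_num [bernoulli'_one]
/-- `[folklore]` the `1/24` of `log det Φ(ad Z_c) = ½ tr ad Z_c + (1/24) tr (ad Z_c)² + …` in (J2). -/
theorem coeff_logPhi_two : coeff 2 (logPhi ℚ) = 1 / 24 := by
  norm_num [bernoulli'_two, Nat.factorial]
/-- `[folklore]` «no cubic term» in `log det Φ`. -/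
theorem coeff_logPhi_three : coeff 3 (logPhi ℚ) = 0 := by norm_num [bernoulli'_three]
/-- `[folklore]` `log Φ = X/2 + X²/24 − X⁴/2880 + …`. -/
theorem coeff_logPhi_four : coeff 4 (logPhi ℚ) = -1 / 2880 := by
  norm_num [bernoulli'_four, Nat.factorial]
/-- `[folklore]` `log Φ − X/2` is even. -/
theorem coeff_logPhi_eq_zero_of_odd {n : ℕ} (hn : Odd n) (h1 : 1 < n) : coeff n (logPhi ℚ) = 0 := by
  simp [bernoulli'_eq_zero_of_odd hn h1]

/-- `[folklore]` second-order coefficients of `log Ψ̃ = X − log Φ`: `+1/2` and `−1/24`. -/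
theorem coeff_X_sub_logPhi_one : coeff 1 (X - logPhi ℚ : PowerSeries ℚ) = 1 / 2 := by
  rw [map_sub, coeff_one_X, coeff_logPhi_one]; norm_num
/-- `[folklore]` `log Ψ̃ = X/2 − X²/24 + …`. -/
theorem coeff_X_sub_logPhi_two : coeff 2 (X - logPhi ℚ : PowerSeries ℚ) = -(1 / 24) := by
  rw [map_sub, coeff_X, coeff_logPhi_two]; norm_num

/-- `[folklore]` the scalar second-order bookkeeping of (J2) in one line: with `Ψ̃ = 1 + u`, `u = X/2 + X²/12 + O(X³)`,
`log(1 + u) = u − u²/2 + O(u³)` has `X²`-coefficient `1/12 − ½·(½)² = −1/24`; and for `Φ = 1 + v`,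
`v = X/2 + X²/6 + O(X³)`: `1/6 − ½·(½)² = 1/24`. -/
theorem second_order_arith : (1 / 12 : ℚ) - (1 / 2) * (1 / 2) ^ 2 = -(1 / 24) ∧
    (1 / 6 : ℚ) - (1 / 2) * (1 / 2) ^ 2 = 1 / 24 := by norm_num

end Coefficients

/-! ## §2. The weighted non-commutative variance identity (the Jensen step of (J2)) -/

section Variance

variable {ι 𝕜 R : Type*} [CommRing 𝕜] [Ring R] [Algebra 𝕜 R]

/-- `[folklore]` For weights `w` with `Σ w = 1` and elements `B x` of a (non-commutative) `𝕜`-algebra,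
`Σ_x w_x B_x² − (Σ_x w_x B_x)² = Σ_x w_x (B_x − B̄)²`, `B̄ := Σ_x w_x B_x`.  In (J2): `w_x = L^{−d}`,
`B_x = ad X_{c,x}`, `B̄ = ad Z_c`. -/
theorem weighted_variance_identity (s : Finset ι) (w : ι → 𝕜) (B : ι → R) (hw : ∑ x ∈ s, w x = 1) :
    ∑ x ∈ s, w x • (B x * B x) - (∑ x ∈ s, w x • B x) * (∑ x ∈ s, w x • B x)
      = ∑ x ∈ s, w x • ((B x - ∑ y ∈ s, w y • B y) * (B x - ∑ y ∈ s, w y • B y)) := by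
  set M := ∑ y ∈ s, w y • B y with hM
  have h1 : ∑ x ∈ s, w x • (B x * M) = M * M := by
    rw [hM, Finset.sum_mul]
    refine Finset.sum_congr rfl fun x _ => ?_
    rw [smul_mul_assoc]
  have h2 : ∑ x ∈ s, w x • (M * B x) = M * M := by
    rw [hM, Finset.mul_sum]
    refine Finset.sum_congr rfl fun x _ => ?_
    rw [mul_smul_comm]
  have h3 : ∑ x ∈ s, w x • (M * M) = M * M := by
    rw [← Finset.sum_smul, hw, one_smul]
  have hexp : ∀ x ∈ s, w x • ((B x - M) * (B x - M))
      = w x • (B x * B x) - w x • (B x * M) - w x • (M * B x) + w x • (M * M) := by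
    intro x _
    rw [show (B x - M) * (B x - M) = B x * B x - B x * M - M * B x + M * M by noncomm_ring]
    rw [smul_add, smul_sub, smul_sub]
  rw [Finset.sum_congr rfl hexp, Finset.sum_add_distrib, Finset.sum_sub_distrib, Finset.sum_sub_distrib,
    h1, h2, h3]
  abel

/-- `[folklore]` the uniform-weight case on a `Fintype` (the block `B(c₋)`, `w ≡ L^{−d} = 1/|B(c₋)|`). -/
theorem uniform_variance_identity [Fintype ι] (c : 𝕜) (B : ι → R) (hc : (Fintype.card ι : 𝕜) * c = 1) :
    ∑ x, c • (B x * B x) - (∑ x, c • B x) * (∑ x, c • B x)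
      = ∑ x, c • ((B x - ∑ y, c • B y) * (B x - ∑ y, c • B y)) :=
  weighted_variance_identity (Finset.univ : Finset ι) (fun _ => c) B (by simpa using hc)

end Variance

/-! ## §3. Real antisymmetric matrices: odd powers traceless, `tr(A²) ≤ 0` -/

section Antisymmetric

variable {n : Type*} [Fintype n]

/-- `[folklore]` the trace of an odd power of a real antisymmetric matrix vanishes (in (J2): `tr ad Z = 0` kills the
linear term of `log det Φ(ad Z)`, `tr (ad Z)³ = 0` the cubic one). -/
theorem trace_pow_eq_zero_of_transpose_eq_neg [DecidableEq n] (M : Matrix n n ℝ) (hM : Mᵀ = -M) {m : ℕ}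
    (hm : Odd m) :
    (M ^ m).trace = 0 := by
  have h : (M ^ m).trace = -(M ^ m).trace := by
    conv_lhs => rw [← Matrix.trace_transpose, Matrix.transpose_pow, hM, hm.neg_pow, Matrix.trace_neg]
  linarith

/-- `[folklore]` an antisymmetric real matrix is traceless (`tr ad Z_c = 0`: no linear term in (J2)). -/
theorem trace_eq_zero_of_transpose_eq_neg [DecidableEq n] (M : Matrix n n ℝ) (hM : Mᵀ = -M) : M.trace = 0 := by
  simpa using trace_pow_eq_zero_of_transpose_eq_neg M hM odd_one

/-- `[folklore]` `tr(A·A) = −Σ_{ij} A_{ij}²` for a real antisymmetric `A` — so `‖Y‖²_ad := −tr (ad Y)²` is a sum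
of squares. -/
theorem trace_mul_self_eq_neg_sum_sq (M : Matrix n n ℝ) (hM : Mᵀ = -M) :
    (M * M).trace = -∑ i, ∑ j, M i j ^ 2 := by
  have h1 : M * M = -(M * Mᵀ) := by rw [hM, Matrix.mul_neg, neg_neg]
  rw [h1, Matrix.trace_neg]
  congr 1
  simp [Matrix.trace, Matrix.mul_apply, sq]

/-- `[folklore]` `tr(A·A) ≤ 0` for antisymmetric real `A` (`‖·‖²_ad ≥ 0`). -/
theorem trace_mul_self_nonpos (M : Matrix n n ℝ) (hM : Mᵀ = -M) : (M * M).trace ≤ 0 := by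
  rw [trace_mul_self_eq_neg_sum_sq M hM, neg_nonpos]
  exact Finset.sum_nonneg fun i _ => Finset.sum_nonneg fun j _ => sq_nonneg _

/-- `[folklore]` `‖Y‖²_ad = 0` only for `ad Y = 0`: `tr(A·A) = 0 ↔ A = 0` for antisymmetric real `A`. -/
theorem trace_mul_self_eq_zero_iff (M : Matrix n n ℝ) (hM : Mᵀ = -M) : (M * M).trace = 0 ↔ M = 0 := by
  constructor
  · intro h
    rw [trace_mul_self_eq_neg_sum_sq M hM, neg_eq_zero] at h
    have hrow : ∀ i, ∑ j, M i j ^ 2 = 0 := fun i =>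
      (Finset.sum_eq_zero_iff_of_nonneg (fun i _ => Finset.sum_nonneg fun j _ => sq_nonneg (M i j))).1 h i
        (Finset.mem_univ i)
    ext i j
    have hij : M i j ^ 2 = 0 :=
      (Finset.sum_eq_zero_iff_of_nonneg (fun j _ => sq_nonneg (M i j))).1 (hrow i) j (Finset.mem_univ j)
    simpa using hij
  · rintro rfl; simp

end Antisymmetric

/-! ## §4. The block second moment `Σ_{0 ≤ i < L} (i − (L−1)/2)² = L(L²−1)/12` -/

section BlockMoment

/-- `[folklore]` `Σ_{i<L} (i − a)² = L(L−1)(2L−1)/6 − 2a·L(L−1)/2 + L·a²`. -/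
theorem sum_range_sq_sub (L : ℕ) (a : ℝ) :
    ∑ i ∈ Finset.range L, ((i : ℝ) - a) ^ 2
      = (L : ℝ) * ((L : ℝ) - 1) * (2 * (L : ℝ) - 1) / 6 - 2 * a * ((L : ℝ) * ((L : ℝ) - 1) / 2)
        + (L : ℝ) * a ^ 2 := by
  induction L with
  | zero => simp
  | succ L ih =>
    rw [Finset.sum_range_succ, ih]
    push_cast
    ring

/-- `[folklore]` the centred second moment of a block line: `Σ_{0 ≤ i < L} (i − (L−1)/2)² = L(L²−1)/12`. -/
theorem sum_range_sq_sub_center (L : ℕ) :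
    ∑ i ∈ Finset.range L, ((i : ℝ) - ((L : ℝ) - 1) / 2) ^ 2 = (L : ℝ) * ((L : ℝ) ^ 2 - 1) / 12 := by
  rw [sum_range_sq_sub]; ring

/-- `[folklore]` the same over `Fin L`. -/
theorem sum_fin_sq_sub_center (L : ℕ) :
    ∑ i : Fin L, (((i : ℕ) : ℝ) - ((L : ℝ) - 1) / 2) ^ 2 = (L : ℝ) * ((L : ℝ) ^ 2 - 1) / 12 := by
  rw [Fin.sum_univ_eq_sum_range (fun i => ((i : ℝ) - ((L : ℝ) - 1) / 2) ^ 2) L]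
  exact sum_range_sq_sub_center L

/-- `[folklore]` BOX FORM (an2's Stokes count): over a box `= line × transverse block β`, the centred second moment
of the line coordinate is `|β|·L(L²−1)/12`. -/
theorem sum_box_sq_sub_center (L : ℕ) (β : Type*) [Fintype β] :
    ∑ x : Fin L × β, ((((x.1 : ℕ) : ℝ)) - ((L : ℝ) - 1) / 2) ^ 2
      = (Fintype.card β : ℝ) * ((L : ℝ) * ((L : ℝ) ^ 2 - 1) / 12) := by
  rw [Fintype.sum_prod_type]
  simp only [Finset.sum_const, Finset.card_univ, nsmul_eq_mul]
  rw [← Finset.mul_sum, sum_fin_sq_sub_center]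

/-- `[folklore]` the `(d+1)`-dimensional block `B(c₋) ≅ Fin L × (Fin d → Fin L)`:
`Σ_{x ∈ B(c₋)} (x_ν − centre)² = L^d · L(L²−1)/12 = L^{d+1}(L²−1)/12`. -/
theorem sum_block_sq_sub_center (L d : ℕ) :
    ∑ x : Fin L × (Fin d → Fin L), ((((x.1 : ℕ) : ℝ)) - ((L : ℝ) - 1) / 2) ^ 2
      = (L : ℝ) ^ (d + 1) * ((L : ℝ) ^ 2 - 1) / 12 := by
  rw [sum_box_sq_sub_center, Fintype.card_fun, Fintype.card_fin, Fintype.card_fin]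
  push_cast
  ring

/-- `[folklore]` (arithmetic) the four block counts printed by JACOBIAN.md §7 (`d = 2, L = 3`: 6; `d = 2, L = 5`: 50; `d = 3, L = 3`: 18;
`d = 4, L = 3`: 54) are `L^d(L²−1)/12`. -/
theorem block_counts :
    (3 : ℚ) ^ 2 * (3 ^ 2 - 1) / 12 = 6 ∧ (5 : ℚ) ^ 2 * (5 ^ 2 - 1) / 12 = 50 ∧
    (3 : ℚ) ^ 3 * (3 ^ 2 - 1) / 12 = 18 ∧ (3 : ℚ) ^ 4 * (3 ^ 2 - 1) / 12 = 54 := by norm_num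

end BlockMoment

/-! ## §5. The arithmetic of the slope `m_J` (AN2.md §8.10 (c); JACOBIAN.md §7) -/

section Slope

/-- `[folklore]` (arithmetic) `2·(1/(12L)) = 1/(6L)`: the (J2) coefficient `1/(12L)` becomes the Hessian coefficient `1/(6L)`
(because `d²/dt² (−κ·t²) = −2κ`, next theorem). -/
theorem hessian_coefficient (L : ℝ) : 2 * (1 / (12 * L)) = 1 / (6 * L) := by
  rcases eq_or_ne L 0 with hL | hL
  · subst hL; simp
  · field_simp; ring

/-- `[folklore]` `d²/dt² (−κ·t²)|₀ = −2κ`. -/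
theorem iteratedDeriv_two_neg_mul_sq (κ : ℝ) : deriv (deriv fun t : ℝ => -κ * t ^ 2) 0 = -2 * κ := by
  have h1 : deriv (fun t : ℝ => -κ * t ^ 2) = fun t => -κ * (2 * t) := by
    funext t
    rw [deriv_const_mul _ (differentiableAt_pow 2), deriv_pow_field]
    ring
  rw [h1, deriv_const_mul _ ((differentiableAt_id).const_mul 2)]
  rw [deriv_const_mul _ differentiableAt_id, deriv_id'']
  ring

/-- `[folklore]` HESSIAN PER IN-PLANE CELL: with `‖X^{(1)}_{c,x}/t‖²_ad = C·L²·(x − c₋)_ν²` and the block count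
`Σ_x (x − c₋)_ν² = L^d(L²−1)/12`,  `−(1/(6L))·C·L²·(L^d(L²−1)/12) = −C·L^{d+1}(L²−1)/72`. -/
theorem hessian_per_cell (C L : ℝ) (d : ℕ) :
    -(1 / (6 * L)) * (C * L ^ 2 * (L ^ d * (L ^ 2 - 1) / 12)) = -(C * L ^ (d + 1) * (L ^ 2 - 1) / 72) := by
  field_simp
  ring

/-- `[folklore]` SLOPE PER UNIT FINE VOLUME: two in-plane cells per coarse site, `L^d` fine sites per coarse site:
`2·(−C·L^{d+1}(L²−1)/72)/L^d = −C·L(L²−1)/36 = m_J`. -/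
theorem slope_per_unit_volume (C L : ℝ) (d : ℕ) (hL : L ≠ 0) :
    2 * (-(C * L ^ (d + 1) * (L ^ 2 - 1) / 72)) / L ^ d = -(C * L * (L ^ 2 - 1) / 36) := by
  have hLd : L ^ d ≠ 0 := pow_ne_zero d hL
  field_simp
  ring

/-- `[folklore]` (arithmetic) the printed toy values (JACOBIAN.md §7, `C_ad = 8` in the `tr = ½Tr` convention of the SU(2) toy):
per cell `−24` (`d=2,L=3`), `−1000/3` (`d=2,L=5`), `−72` (`d=3,L=3`), `−216` (`d=4,L=3`); per unit fine volume
`−16/3` (`L=3`), `−80/3` (`L=5`). -/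
theorem toy_values :
    -(8 * (3 : ℚ) ^ 3 * (3 ^ 2 - 1) / 72) = -24 ∧ -(8 * (5 : ℚ) ^ 3 * (5 ^ 2 - 1) / 72) = -1000 / 3 ∧
    -(8 * (3 : ℚ) ^ 4 * (3 ^ 2 - 1) / 72) = -72 ∧ -(8 * (3 : ℚ) ^ 5 * (3 ^ 2 - 1) / 72) = -216 ∧
    -(8 * (3 : ℚ) * (3 ^ 2 - 1) / 36) = -16 / 3 ∧ -(8 * (5 : ℚ) * (5 ^ 2 - 1) / 36) = -80 / 3 := by
  norm_num

end Slope

/-! ## Non-vacuity examples -/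

section Examples

/-- §2 is not vacuous: two non-commuting `2 × 2` matrices with weights `½, ½`. -/
example : let B₁ : Matrix (Fin 2) (Fin 2) ℚ := !![0, 1; 0, 0]
    let B₂ : Matrix (Fin 2) (Fin 2) ℚ := !![0, 0; 1, 0]
    (1 / 2 : ℚ) • (B₁ * B₁) + (1 / 2 : ℚ) • (B₂ * B₂)
      - ((1 / 2 : ℚ) • B₁ + (1 / 2 : ℚ) • B₂) * ((1 / 2 : ℚ) • B₁ + (1 / 2 : ℚ) • B₂)
      = (1 / 2 : ℚ) • ((B₁ - ((1 / 2 : ℚ) • B₁ + (1 / 2 : ℚ) • B₂)) * (B₁ - ((1 / 2 : ℚ) • B₁ + (1 / 2 : ℚ) • B₂)))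
        + (1 / 2 : ℚ) • ((B₂ - ((1 / 2 : ℚ) • B₁ + (1 / 2 : ℚ) • B₂)) * (B₂ - ((1 / 2 : ℚ) • B₁ + (1 / 2 : ℚ) • B₂))) := by
  simp only
  ext i j; fin_cases i <;> fin_cases j <;> norm_num [Matrix.mul_apply, Fin.sum_univ_two]

/-- §3 is not vacuous: the generator of rotations. -/
example : (!![(0 : ℝ), 1; -1, 0])ᵀ = -!![(0 : ℝ), 1; -1, 0] ∧ (!![(0 : ℝ), 1; -1, 0] * !![(0 : ℝ), 1; -1, 0]).trace = -2 := by
  constructor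
  · ext i j; fin_cases i <;> fin_cases j <;> simp
  · simp [Matrix.trace, Fin.sum_univ_two]; norm_num

end Examples

end Literature.MathematicalPhysics.QuantumFieldTheory.Balaban1983to89.Beta.ElimJacobianAlgebra
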